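import Summits.QuantumFields.YangMills.Theorems.BalabanUVNodesRateCarriersOfRecord12

/-!
# THE TUPLE-KEYED AND REGIME-RESTRICTED RATE-CARRIER PREDICATES AT STAGE 12 — `YMDAG.UVSplit.RRec₁₂On 𝔯 Rg : RateRecordPred N`: at `(F, D, g₀, os)` it pins the
# bundles of EVERY admissible Stage-12 tuple `θ` with provisos IN THE REGIME `Rg F θ` whose datum of record IS `D`, read AT `θ` ITSELF (not at the canonical parameter);
# the (T-RATE) twin of (T-SPINE)'s `SRec₁₂On cr Rg` (dag-n20-d, p466448 §4), so that a K3′ composer can read the K4 rate stubs WITH THE GUARD INSIDE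
# (`∀ θ hP, Rg F θ → θ.Admissible F N → …` — dag-ref-H XXVII-PRE-READ-NOTE (b), pub-ymgap INBOX l.13791) and at the SAME tuple as the spine bundle

Track A of `YM-PLAN.md` (cell `pub-ymgap`, HUMAN RULING D-0062), R134 seat `pub-ymgap-dag-n22-e` ((T-RATE) pen), gen 2, module 5.  WHY.  Layer B at ₁₂ (p466281) keys
`RRec₁₂ 𝔯` by RR-2's CANONICAL datum key: bundles are read at `h.params := Classical.choose h`, SOME admissible tuple with provisos realising `D`.  After rev 15 the items K2′∕K3′
guard the tuple (`θ.ZtUnity F 2 → θ.SlotsNondegenerate → …`, director-ym LINE №99 ∕ №109), and a guard on θ does NOT reach `h.params` (dag-ref-H l.13791; dag-lead WORDS-110: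
the landed C-keyed homes STAY — a stub over the weaker key is the stronger statement — and regime-consuming readings get a key of their own).  This module supplies, on the
rate side, exactly what (T-SPINE) already has on the spine side: the TUPLE-keyed predicate restricted to an arbitrary regime `Rg`, its one-application faces, and the
comparison with the canonical home.  Definition lane (ONE `def`); every theorem is kernel bookkeeping; 0 `sorry`; COUNT-NEUTRAL; `--supports` K3′ `SpineGivenEndpointR12`
(stmt-QuantumFields-19792).  Restate-immune (no Theses import); nothing landed is re-keyed.

WHAT THIS MODULE PROVES ([bookkeeping]).
* §1 `RRec₁₂On 𝔯 Rg` · `rRec₁₂On_iff` (`Iff.rfl`) · `rRec₁₂On_self` · `RRec₁₂On.stage12 ∕ .isDatumOfRecord₁₂C ∕ .window ∕ .moduli ∕ .gamma_pos ∕ .other_level` · `rRec₁₂On_mono` (a larger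
  regime pins more) · `rRec₁₂_le_rRec₁₂On_true` (the canonical home's bundles are among the tuple-keyed ones at the trivial regime) · `rRec₁₂On_of_regime_params` (… and among
  the `Rg`-restricted ones whenever the canonical parameters lie in `Rg`).
* §2 THE GUARDED θ-FORMS: `rateStub_rRec₁₂On_iff` (master) · `s_N14 ∕ s_N15 ∕ s_N16 ∕ s_N17 ∕ s_N18 ∕ s_N22 ∕ s_D4_rRec₁₂On_iff` — each K4 stub at `RRec₁₂On 𝔯 Rg` IS
  «for every family, every admissible θ with provisos IN `Rg`, every `g₀, os, k`: the node's estimate at `rateCarriersOfRecord₁₂ 𝔯 F θ hP g₀ os k` (on the datum `datumOfRecord₁₂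
  F N θ hP` for N17 ∕ (D4))» · `rateInputsAll_rRec₁₂On_iff`.
* §3 TRANSFERS: `k4_rRec₁₂On_anti` (antitone in the regime: stubs over a larger regime give stubs over a smaller one) · `k4_rRec₁₂_of_rRec₁₂On_true` (stubs at the tuple-keyed home
  ⟹ stubs at the canonical home `RRec₁₂ 𝔯`) · `s_R00x_rRec₁₂On_of_regime` (existence at every record of a record class whose records come with a θ IN THE REGIME — e.g. the
  regime-restricted record class a θ-keyed K3′ composer quantifies over) · `s_R00x_rRec₁₂On_true`.
* §4 the UNITY ∕ GUARD instances are ONE-LINERS: `RRec₁₂On 𝔯 (fun F θ => θ.ZtUnity F N)` etc. — no further `def` (regimes are parameters; rev 15's guard is spelled by the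
  composer).
* §5 THE K3′ SKELETON's `stub_rates12` SHAPE FROM THE HOME (plan g64 `K3Skeleton12.lean`, stmt-QuantumFields-19908): `rateCarriersOfRecord₁₂_u3_γ` (`KeyedWindow` by `rfl`),
  `ratesAt_of_k4_rRec₁₂On` (the six stubs at the tuple-keyed home ⇒ `RatesAt` at every tuple-level bundle on its datum), `exists_keyedRates_window_of_k4_rRec₁₂On_true(_glueN17)`
  (⇒ `∃ rr, KeyedRates rr ∧ KeyedWindow rr` UNFOLDED, witness = the level-selected home reading) — the junction only; the six node estimates stay the stubs' content.

HONEST FRAMING.  PINS ONLY; the reading `𝔯` is residual; nothing of Bałaban's is asserted; NE1′ ∕ … ∕ NE9 NOT PRINTED for d = 4 and NOT PROVED; no inhabitant of any key claimed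
(K0′ open); no node discharged; counts UNMOVED (typed 28∕28 · discharged 5∕27, A 5∕28); one finite four-torus programme at fixed `ε` — NOT ℝ⁴, NOT infinite volume, NOT OS, NOT a
mass gap, NOT Clay.  No decl below carries a cite tag.
-/

noncomputable section

namespace YMDAG.UVSplit

open Literature.MathematicalPhysics.QuantumFieldTheory.Balaban1983to89
open Literature.MathematicalPhysics.QuantumFieldTheory.Balaban1983to89.T4Continuum
open Literature.MathematicalPhysics.QuantumFieldTheory.Balaban1983to89.T4OutputRate (Window)
open Node00 (Stage12Params datumOfRecord₁₂ IsRecordOfRecord₁₂C IsDatumOfRecord₁₂C)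

variable {N : ℕ} [NeZero N]

/-! ## §1 The regime-restricted, tuple-keyed rate-carrier predicate -/

/-- **THE `Rg`-RESTRICTED, TUPLE-KEYED RATE-CARRIER PREDICATE OF RECORD, STAGE 12** (PINS ONLY): at `(F, D, g₀, os)` it pins the bundles of every run length `k` read from `𝔯`
AT every admissible Stage-12 tuple `θ` with provisos `hP` IN THE REGIME `Rg F θ` whose datum of record IS `D`. -/
def RRec₁₂On (𝔯 : RateReading₁₂ N) (Rg : (F : T4Family) → Stage12Params F N → Prop) : RateRecordPred N :=
  fun F D g₀ os R => ∃ (θ : Stage12Params F N) (hP : θ.Provisos₁₂ F N), Rg F θ ∧ θ.Admissible F N ∧ D = datumOfRecord₁₂ F N θ hP ∧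
    ∃ k : ℕ, R = rateCarriersOfRecord₁₂ 𝔯 F θ hP g₀ os k

variable (𝔯 : RateReading₁₂ N) (Rg : (F : T4Family) → Stage12Params F N → Prop)

/-- Unfolding (`Iff.rfl`). -/
theorem rRec₁₂On_iff {F : T4Family} (D : Datum F N) (g₀ : ℕ → ℝ) (os : List (ULoop F)) (R : RateCarriers N) :
    RRec₁₂On 𝔯 Rg F D g₀ os R ↔ ∃ (θ : Stage12Params F N) (hP : θ.Provisos₁₂ F N), Rg F θ ∧ θ.Admissible F N ∧ D = datumOfRecord₁₂ F N θ hP ∧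
      ∃ k : ℕ, R = rateCarriersOfRecord₁₂ 𝔯 F θ hP g₀ os k :=
  Iff.rfl

/-- **IN THE REGIME, EVERY RUN LENGTH OF THE READING AT `θ` IS PINNED AT `θ`'s OWN DATUM.** -/
theorem rRec₁₂On_self {F : T4Family} (θ : Stage12Params F N) (hP : θ.Provisos₁₂ F N) (hRg : Rg F θ) (hθ : θ.Admissible F N) (g₀ : ℕ → ℝ)
    (os : List (ULoop F)) (k : ℕ) : RRec₁₂On 𝔯 Rg F (datumOfRecord₁₂ F N θ hP) g₀ os (rateCarriersOfRecord₁₂ 𝔯 F θ hP g₀ os k) :=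
  ⟨θ, hP, hRg, hθ, rfl, k, rfl⟩

namespace RRec₁₂On

variable {𝔯 Rg} {F : T4Family} {D : Datum F N} {g₀ : ℕ → ℝ} {os : List (ULoop F)} {R : RateCarriers N}

/-- **TYPED OVER STAGE 12, IN THE REGIME**: a pinned bundle comes with an admissible tuple with provisos in `Rg` realising the datum, at which it is read, and whose window IS the
bundle's radius. -/
theorem stage12 (hR : RRec₁₂On 𝔯 Rg F D g₀ os R) :
    ∃ (θ : Stage12Params F N) (hP : θ.Provisos₁₂ F N) (k : ℕ), Rg F θ ∧ θ.Admissible F N ∧ D = datumOfRecord₁₂ F N θ hP ∧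
      R = rateCarriersOfRecord₁₂ 𝔯 F θ hP g₀ os k ∧ R.u3.γ = θ.γ := by
  obtain ⟨θ, hP, hRg, hθ, hD, k, rfl⟩ := hR
  exact ⟨θ, hP, k, hRg, hθ, hD, rfl, rfl⟩

/-- The datum of a pinned bundle is a Stage-12 datum of record (the C key forgets the regime). -/
theorem isDatumOfRecord₁₂C (hR : RRec₁₂On 𝔯 Rg F D g₀ os R) : IsDatumOfRecord₁₂C F N D := by
  obtain ⟨θ, hP, -, hθ, hD, -⟩ := hR
  rw [hD]
  exact Node00.isDatumOfRecord₁₂C_datumOfRecord₁₂ F N θ hP hθ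

/-- The bundle's window IS `Window R.u3.γ`. -/
theorem window (hR : RRec₁₂On 𝔯 Rg F D g₀ os R) : R.u3.W = Window R.u3.γ := by
  obtain ⟨θ, hP, -, -, -, k, rfl⟩ := hR
  rfl

/-- The bundle's moduli ARE `C₉·ω^{k−i}`. -/
theorem moduli (hR : RRec₁₂On 𝔯 Rg F D g₀ os R) : R.u3.Λ = fun a i => R.u3.C₉ * R.u3.ω ^ (a - i) := by
  obtain ⟨θ, hP, -, -, -, k, rfl⟩ := hR
  rfl

/-- The bundle's radius is positive. -/
theorem gamma_pos (hR : RRec₁₂On 𝔯 Rg F D g₀ os R) : 0 < R.u3.γ := by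
  obtain ⟨θ, hP, -, hθ, -, k, rfl⟩ := hR
  exact hθ.toStage9.gamma_pos

/-- **THE TOWER KEY, IN THE REGIME**: every other run length of the reading AT THE SAME TUPLE is pinned at the same datum. -/
theorem other_level (hR : RRec₁₂On 𝔯 Rg F D g₀ os R) (k' : ℕ) :
    ∃ (θ : Stage12Params F N) (hP : θ.Provisos₁₂ F N) (k : ℕ), R = rateCarriersOfRecord₁₂ 𝔯 F θ hP g₀ os k ∧
      RRec₁₂On 𝔯 Rg F D g₀ os (rateCarriersOfRecord₁₂ 𝔯 F θ hP g₀ os k') := by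
  obtain ⟨θ, hP, hRg, hθ, hD, k, rfl⟩ := hR
  exact ⟨θ, hP, k, rfl, θ, hP, hRg, hθ, hD, k', rfl⟩

end RRec₁₂On

/-- **MONOTONE IN THE REGIME**: a larger regime pins more bundles. -/
theorem rRec₁₂On_mono {Rg Rg' : (F : T4Family) → Stage12Params F N → Prop} (h : ∀ F θ, Rg F θ → Rg' F θ) {F : T4Family} {D : Datum F N} {g₀ : ℕ → ℝ}
    {os : List (ULoop F)} {R : RateCarriers N} (hR : RRec₁₂On 𝔯 Rg F D g₀ os R) : RRec₁₂On 𝔯 Rg' F D g₀ os R := by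
  obtain ⟨θ, hP, hRg, hθ, hD, k, hk⟩ := hR
  exact ⟨θ, hP, h F θ hRg, hθ, hD, k, hk⟩

/-- **THE CANONICAL HOME PINS A SUB-CLASS OF THE TUPLE-KEYED HOME AT THE TRIVIAL REGIME**: the canonical parameter `h.params` is one admissible tuple with provisos realising `D`. -/
theorem rRec₁₂_le_rRec₁₂On_true {F : T4Family} {D : Datum F N} {g₀ : ℕ → ℝ} {os : List (ULoop F)} {R : RateCarriers N} (hR : RRec₁₂ 𝔯 F D g₀ os R) :
    RRec₁₂On 𝔯 (fun _ _ => True) F D g₀ os R := by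
  obtain ⟨h, k, rfl⟩ := hR
  exact ⟨h.params, h.provisos, trivial, h.admissible, h.eq_datumOfRecord₁₂, k, rfl⟩

/-- … and of the `Rg`-restricted home whenever the canonical parameters of the data of record lie IN `Rg`. -/
theorem rRec₁₂On_of_regime_params (hreg : ∀ (F : T4Family) (D : Datum F N) (h : IsDatumOfRecord₁₂C F N D), Rg F h.params) {F : T4Family} {D : Datum F N}
    {g₀ : ℕ → ℝ} {os : List (ULoop F)} {R : RateCarriers N} (hR : RRec₁₂ 𝔯 F D g₀ os R) : RRec₁₂On 𝔯 Rg F D g₀ os R := by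
  obtain ⟨h, k, rfl⟩ := hR
  exact ⟨h.params, h.provisos, hreg F D h, h.admissible, h.eq_datumOfRecord₁₂, k, rfl⟩

/-! ## §2 The GUARDED θ-forms of the K4 stubs at `RRec₁₂On 𝔯 Rg` -/

/-- **THE MASTER FACE**: a stub «for every pinned bundle, `P D R`» at `RRec₁₂On 𝔯 Rg` IS «for every family, every admissible θ with provisos IN THE REGIME, every `g₀, os, k`:
`P (datumOfRecord₁₂ F N θ hP) (rateCarriersOfRecord₁₂ 𝔯 F θ hP g₀ os k)`» — the guard sits INSIDE, and the bundle is read AT θ. -/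
theorem rateStub_rRec₁₂On_iff (P : ∀ {F : T4Family}, Datum F N → RateCarriers N → Prop) :
    (∀ (F : T4Family) (D : Datum F N) (g₀ : ℕ → ℝ) (os : List (ULoop F)) (R : RateCarriers N), RRec₁₂On 𝔯 Rg F D g₀ os R → P D R) ↔
      ∀ (F : T4Family) (θ : Stage12Params F N) (hP : θ.Provisos₁₂ F N), Rg F θ → θ.Admissible F N →
        ∀ (g₀ : ℕ → ℝ) (os : List (ULoop F)) (k : ℕ), P (datumOfRecord₁₂ F N θ hP) (rateCarriersOfRecord₁₂ 𝔯 F θ hP g₀ os k) := by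
  constructor
  · intro hS F θ hP hRg hθ g₀ os k
    exact hS F _ g₀ os _ (rRec₁₂On_self 𝔯 Rg θ hP hRg hθ g₀ os k)
  · rintro hS F D g₀ os R ⟨θ, hP, hRg, hθ, rfl, k, rfl⟩
    exact hS F θ hP hRg hθ g₀ os k

/-- **N14 at the regime-restricted home** (guarded θ-form). -/
theorem s_N14_rRec₁₂On_iff : S_N14 (RRec₁₂On 𝔯 Rg) ↔ ∀ (F : T4Family) (θ : Stage12Params F N) (hP : θ.Provisos₁₂ F N), Rg F θ → θ.Admissible F N →
    ∀ (g₀ : ℕ → ℝ) (os : List (ULoop F)), N14At (𝔯.ne1 F θ hP g₀ os) :=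
  (rateStub_rRec₁₂On_iff 𝔯 Rg fun _ R => N14At R.ne1).trans
    ⟨fun h F θ hP hRg hθ g₀ os => h F θ hP hRg hθ g₀ os 0, fun h F θ hP hRg hθ g₀ os _ => h F θ hP hRg hθ g₀ os⟩

/-- **N15 at the regime-restricted home** (guarded θ-form). -/
theorem s_N15_rRec₁₂On_iff : S_N15 (RRec₁₂On 𝔯 Rg) ↔ ∀ (F : T4Family) (θ : Stage12Params F N) (hP : θ.Provisos₁₂ F N), Rg F θ → θ.Admissible F N →
    ∀ (g₀ : ℕ → ℝ) (os : List (ULoop F)) (k : ℕ), N15At (ne2OfRecord₁₁ ((𝔯.lit F θ hP g₀ os).ne2 k)) :=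
  rateStub_rRec₁₂On_iff 𝔯 Rg fun _ R => N15At R.ne2

/-- **N16 at the regime-restricted home** (guarded θ-form). -/
theorem s_N16_rRec₁₂On_iff : S_N16 (RRec₁₂On 𝔯 Rg) ↔ ∀ (F : T4Family) (θ : Stage12Params F N) (hP : θ.Provisos₁₂ F N), Rg F θ → θ.Admissible F N →
    ∀ (g₀ : ℕ → ℝ) (os : List (ULoop F)) (k : ℕ), N16At (ne3OfRecord₁₁ F ((𝔯.lit F θ hP g₀ os).ne3 k)) :=
  rateStub_rRec₁₂On_iff 𝔯 Rg fun _ R => N16At R.ne3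

/-- **N17 at the regime-restricted home** (guarded θ-form, ON THE DATUM `datumOfRecord₁₂ F N θ hP`). -/
theorem s_N17_rRec₁₂On_iff : S_N17 (RRec₁₂On 𝔯 Rg) ↔ ∀ (F : T4Family) (θ : Stage12Params F N) (hP : θ.Provisos₁₂ F N), Rg F θ → θ.Admissible F N →
    ∀ (g₀ : ℕ → ℝ) (os : List (ULoop F)) (k : ℕ), N17At (datumOfRecord₁₂ F N θ hP) (u3OfRecord₁₂ θ (𝔯.lit F θ hP g₀ os).u3 k) :=
  rateStub_rRec₁₂On_iff 𝔯 Rg fun D R => N17At D R.u3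

/-- **N18 at the regime-restricted home** (guarded θ-form). -/
theorem s_N18_rRec₁₂On_iff : S_N18 (RRec₁₂On 𝔯 Rg) ↔ ∀ (F : T4Family) (θ : Stage12Params F N) (hP : θ.Provisos₁₂ F N), Rg F θ → θ.Admissible F N →
    ∀ (g₀ : ℕ → ℝ) (os : List (ULoop F)) (k : ℕ), N18At (u3OfRecord₁₂ θ (𝔯.lit F θ hP g₀ os).u3 k) :=
  rateStub_rRec₁₂On_iff 𝔯 Rg fun _ R => N18At R.u3

/-- **N22 at the regime-restricted home** (guarded θ-form). -/
theorem s_N22_rRec₁₂On_iff : S_N22 (RRec₁₂On 𝔯 Rg) ↔ ∀ (F : T4Family) (θ : Stage12Params F N) (hP : θ.Provisos₁₂ F N), Rg F θ → θ.Admissible F N →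
    ∀ (g₀ : ℕ → ℝ) (os : List (ULoop F)) (k : ℕ), N22At (u3OfRecord₁₂ θ (𝔯.lit F θ hP g₀ os).u3 k) :=
  rateStub_rRec₁₂On_iff 𝔯 Rg fun _ R => N22At R.u3

/-- **(D4) at the regime-restricted home** (guarded θ-form, on the datum). -/
theorem s_D4_rRec₁₂On_iff : S_D4 (RRec₁₂On 𝔯 Rg) ↔ ∀ (F : T4Family) (θ : Stage12Params F N) (hP : θ.Provisos₁₂ F N), Rg F θ → θ.Admissible F N →
    ∀ (g₀ : ℕ → ℝ) (os : List (ULoop F)) (k : ℕ), ReadOutAt (datumOfRecord₁₂ F N θ hP) (u3OfRecord₁₂ θ (𝔯.lit F θ hP g₀ os).u3 k) :=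
  rateStub_rRec₁₂On_iff 𝔯 Rg fun D R => ReadOutAt D R.u3

/-- **K4's ∀-HOOK at the regime-restricted home**: at `(F, D, g₀, os)`, «the six in-edges at every run length of the reading AT EVERY admissible tuple with provisos in `Rg`
realising `D`». -/
theorem rateInputsAll_rRec₁₂On_iff {F : T4Family} (D : Datum F N) (g₀ : ℕ → ℝ) (os : List (ULoop F)) :
    RateInputsAll (RRec₁₂On 𝔯 Rg) F D g₀ os ↔ ∀ (θ : Stage12Params F N) (hP : θ.Provisos₁₂ F N), Rg F θ → θ.Admissible F N →
      D = datumOfRecord₁₂ F N θ hP → ∀ k : ℕ, RatesAt D (rateCarriersOfRecord₁₂ 𝔯 F θ hP g₀ os k) := by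
  constructor
  · intro hall θ hP hRg hθ hD k
    exact hall _ ⟨θ, hP, hRg, hθ, hD, k, rfl⟩
  · rintro hall R ⟨θ, hP, hRg, hθ, hD, k, rfl⟩
    exact hall θ hP hRg hθ hD k

/-! ## §3 Transfers: antitone in the regime; to the canonical home; existence at a regime-restricted record class -/

/-- **THE SEVEN K4 STUBS ARE ANTITONE IN THE REGIME**: proved over a larger regime, they hold over every smaller one. -/
theorem k4_rRec₁₂On_anti {Rg Rg' : (F : T4Family) → Stage12Params F N → Prop} (h : ∀ F θ, Rg F θ → Rg' F θ) :
    (S_N14 (RRec₁₂On 𝔯 Rg') → S_N14 (RRec₁₂On 𝔯 Rg)) ∧ (S_N15 (RRec₁₂On 𝔯 Rg') → S_N15 (RRec₁₂On 𝔯 Rg)) ∧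
      (S_N16 (RRec₁₂On 𝔯 Rg') → S_N16 (RRec₁₂On 𝔯 Rg)) ∧ (S_N17 (RRec₁₂On 𝔯 Rg') → S_N17 (RRec₁₂On 𝔯 Rg)) ∧
      (S_N18 (RRec₁₂On 𝔯 Rg') → S_N18 (RRec₁₂On 𝔯 Rg)) ∧ (S_N22 (RRec₁₂On 𝔯 Rg') → S_N22 (RRec₁₂On 𝔯 Rg)) ∧
      (S_D4 (RRec₁₂On 𝔯 Rg') → S_D4 (RRec₁₂On 𝔯 Rg)) :=
  ⟨fun hS F D g₀ os R hR => hS F D g₀ os R (rRec₁₂On_mono 𝔯 h hR), fun hS F D g₀ os R hR => hS F D g₀ os R (rRec₁₂On_mono 𝔯 h hR),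
    fun hS F D g₀ os R hR => hS F D g₀ os R (rRec₁₂On_mono 𝔯 h hR), fun hS F D g₀ os R hR => hS F D g₀ os R (rRec₁₂On_mono 𝔯 h hR),
    fun hS F D g₀ os R hR => hS F D g₀ os R (rRec₁₂On_mono 𝔯 h hR), fun hS F D g₀ os R hR => hS F D g₀ os R (rRec₁₂On_mono 𝔯 h hR),
    fun hS F D g₀ os R hR => hS F D g₀ os R (rRec₁₂On_mono 𝔯 h hR)⟩

/-- **STUBS AT THE TUPLE-KEYED HOME GIVE STUBS AT THE CANONICAL HOME** `RRec₁₂ 𝔯` (layer B, p466281) — `rRec₁₂_le_rRec₁₂On_true`. -/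
theorem k4_rRec₁₂_of_rRec₁₂On_true :
    (S_N14 (RRec₁₂On 𝔯 fun _ _ => True) → S_N14 (RRec₁₂ 𝔯)) ∧ (S_N15 (RRec₁₂On 𝔯 fun _ _ => True) → S_N15 (RRec₁₂ 𝔯)) ∧
      (S_N16 (RRec₁₂On 𝔯 fun _ _ => True) → S_N16 (RRec₁₂ 𝔯)) ∧ (S_N17 (RRec₁₂On 𝔯 fun _ _ => True) → S_N17 (RRec₁₂ 𝔯)) ∧
      (S_N18 (RRec₁₂On 𝔯 fun _ _ => True) → S_N18 (RRec₁₂ 𝔯)) ∧ (S_N22 (RRec₁₂On 𝔯 fun _ _ => True) → S_N22 (RRec₁₂ 𝔯)) ∧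
      (S_D4 (RRec₁₂On 𝔯 fun _ _ => True) → S_D4 (RRec₁₂ 𝔯)) :=
  ⟨fun hS F D g₀ os R hR => hS F D g₀ os R (rRec₁₂_le_rRec₁₂On_true 𝔯 hR), fun hS F D g₀ os R hR => hS F D g₀ os R (rRec₁₂_le_rRec₁₂On_true 𝔯 hR),
    fun hS F D g₀ os R hR => hS F D g₀ os R (rRec₁₂_le_rRec₁₂On_true 𝔯 hR), fun hS F D g₀ os R hR => hS F D g₀ os R (rRec₁₂_le_rRec₁₂On_true 𝔯 hR),
    fun hS F D g₀ os R hR => hS F D g₀ os R (rRec₁₂_le_rRec₁₂On_true 𝔯 hR), fun hS F D g₀ os R hR => hS F D g₀ os R (rRec₁₂_le_rRec₁₂On_true 𝔯 hR),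
    fun hS F D g₀ os R hR => hS F D g₀ os R (rRec₁₂_le_rRec₁₂On_true 𝔯 hR)⟩

/-- **`S_R00x` AT THE REGIME-RESTRICTED HOME FOR A REGIME-RESTRICTED RECORD CLASS**: if every record `(D, w)` of `Rec` comes with an admissible tuple with provisos IN THE
REGIME realising `D` (e.g. `Rec` = the `Rg`-guarded Stage-12 record class a θ-keyed K3′ composer quantifies over), the rate carriers of record EXIST under the pins for every
tuned run and loop string — witness run length `0` at that tuple.  Existence is free (objects residual). -/
theorem s_R00x_rRec₁₂On_of_regime {Rec : RecordPred N}
    (hRec : ∀ (F : T4Family) (D : Datum F N) (w : DagBinding.WorldP), Rec F D w →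
      ∃ (θ : Stage12Params F N) (hP : θ.Provisos₁₂ F N), Rg F θ ∧ θ.Admissible F N ∧ D = datumOfRecord₁₂ F N θ hP) :
    S_R00x Rec (RRec₁₂On 𝔯 Rg) := by
  intro F D w hR _ _
  obtain ⟨θ, hP, hRg, hθ, hD⟩ := hRec F D w hR
  exact T4ContinuumYM4Torus.ForSmallCouplings.of_forall fun g₀ os => ⟨_, θ, hP, hRg, hθ, hD, 0, rfl⟩

/-- **… in particular at the UNRESTRICTED Stage-12 record class and the trivial regime** (`Node00.exists_provisos_of_isRecordOfRecord₁₂C`). -/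
theorem s_R00x_rRec₁₂On_true : S_R00x (fun F D w => IsRecordOfRecord₁₂C F N D w) (RRec₁₂On 𝔯 fun _ _ => True) :=
  s_R00x_rRec₁₂On_of_regime 𝔯 _ fun F D w hR => by
    obtain ⟨θ, hP, hθ, hD⟩ := Node00.exists_provisos_of_isRecordOfRecord₁₂C hR
    exact ⟨θ, hP, trivial, hθ, hD⟩

/-! ## §4 The unity instance is a one-liner (no further `def`) -/

/-- **EXAMPLE OF RECORD — THE UNITY REGIME** (director-ym LINE №99: print's partition of unity `θ.ZtUnity`): N22's stub at the unity-restricted tuple-keyed home IS the guarded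
θ-form «for every admissible θ with provisos AND `θ.ZtUnity F N`, every `g₀, os, k`: `N22At` at the bundle read at θ». -/
theorem s_N22_rRec₁₂On_ztUnity_iff :
    S_N22 (RRec₁₂On 𝔯 fun F θ => θ.ZtUnity F N) ↔ ∀ (F : T4Family) (θ : Stage12Params F N) (hP : θ.Provisos₁₂ F N), θ.ZtUnity F N → θ.Admissible F N →
      ∀ (g₀ : ℕ → ℝ) (os : List (ULoop F)) (k : ℕ), N22At (u3OfRecord₁₂ θ (𝔯.lit F θ hP g₀ os).u3 k) :=
  s_N22_rRec₁₂On_iff 𝔯 _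

/-! ## §5 The K3′ skeleton's `stub_rates12` shape from the tuple-keyed home (plan g64 `K3Skeleton12.lean`, stubs of stmt-QuantumFields-19908: a SINGLE-BUNDLE tuple reading
`rr : (F θ hP g₀ os) ↦ RateCarriers N` with `KeyedRates rr` — the six rates at every admissible tuple ON ITS DATUM — and `KeyedWindow rr` — `(rr …).u3.γ = θ.γ`) -/

/-- The tuple-level bundle's window radius IS `θ.γ` (`rfl`) — `KeyedWindow` of every level-selected reading `fun F θ hP g₀ os => rateCarriersOfRecord₁₂ 𝔯 F θ hP g₀ os (ksel …)`. -/
theorem rateCarriersOfRecord₁₂_u3_γ (F : T4Family) (θ : Stage12Params F N) (hP : θ.Provisos₁₂ F N) (g₀ : ℕ → ℝ) (os : List (ULoop F)) (k : ℕ) :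
    (rateCarriersOfRecord₁₂ 𝔯 F θ hP g₀ os k).u3.γ = θ.γ := rfl

/-- **THE SIX K4 STUBS AT THE TUPLE-KEYED HOME GIVE THE SIX RATES AT EVERY TUPLE-LEVEL BUNDLE ON ITS DATUM** (regime `Rg`; `RatesAt` = N14 ∧ N15 ∧ N16 ∧ N17 ∧ N18 ∧ N22). -/
theorem ratesAt_of_k4_rRec₁₂On (h14 : S_N14 (RRec₁₂On 𝔯 Rg)) (h15 : S_N15 (RRec₁₂On 𝔯 Rg)) (h16 : S_N16 (RRec₁₂On 𝔯 Rg)) (h17 : S_N17 (RRec₁₂On 𝔯 Rg))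
    (h18 : S_N18 (RRec₁₂On 𝔯 Rg)) (h22 : S_N22 (RRec₁₂On 𝔯 Rg)) (F : T4Family) (θ : Stage12Params F N) (hP : θ.Provisos₁₂ F N) (hRg : Rg F θ)
    (hθ : θ.Admissible F N) (g₀ : ℕ → ℝ) (os : List (ULoop F)) (k : ℕ) :
    RatesAt (datumOfRecord₁₂ F N θ hP) (rateCarriersOfRecord₁₂ 𝔯 F θ hP g₀ os k) :=
  have hR := rRec₁₂On_self 𝔯 Rg θ hP hRg hθ g₀ os k
  ⟨h14 F _ g₀ os _ hR, h15 F _ g₀ os _ hR, h16 F _ g₀ os _ hR, h17 F _ g₀ os _ hR, h18 F _ g₀ os _ hR, h22 F _ g₀ os _ hR⟩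

/-- **`stub_rates12`'s BODY FROM THE HOME** (N-generic, `KeyedRates`∕`KeyedWindow` unfolded): the six K4 stubs at the tuple-keyed home at the trivial regime give, for ANY
run-length selector `ksel`, a single-bundle tuple reading `rr` carrying the six rates at every admissible tuple on its datum and whose U3 window IS the record's — witness
`rr F θ hP g₀ os := rateCarriersOfRecord₁₂ 𝔯 F θ hP g₀ os (ksel F θ g₀ os)`.  The K3′ line lead supplies the six stubs (the nodes' estimates at a NAMED `𝔯`); this is the
junction, not an estimate. -/
theorem exists_keyedRates_window_of_k4_rRec₁₂On_true (ksel : (F : T4Family) → Stage12Params F N → (ℕ → ℝ) → List (ULoop F) → ℕ)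
    (h14 : S_N14 (RRec₁₂On 𝔯 fun _ _ => True)) (h15 : S_N15 (RRec₁₂On 𝔯 fun _ _ => True)) (h16 : S_N16 (RRec₁₂On 𝔯 fun _ _ => True))
    (h17 : S_N17 (RRec₁₂On 𝔯 fun _ _ => True)) (h18 : S_N18 (RRec₁₂On 𝔯 fun _ _ => True)) (h22 : S_N22 (RRec₁₂On 𝔯 fun _ _ => True)) :
    ∃ rr : (F : T4Family) → (θ : Stage12Params F N) → θ.Provisos₁₂ F N → (ℕ → ℝ) → List (ULoop F) → RateCarriers N,
      (∀ (F : T4Family) (θ : Stage12Params F N) (hP : θ.Provisos₁₂ F N), θ.Admissible F N → ∀ (g₀ : ℕ → ℝ) (os : List (ULoop F)),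
          RatesAt (datumOfRecord₁₂ F N θ hP) (rr F θ hP g₀ os)) ∧
        ∀ (F : T4Family) (θ : Stage12Params F N) (hP : θ.Provisos₁₂ F N) (g₀ : ℕ → ℝ) (os : List (ULoop F)), (rr F θ hP g₀ os).u3.γ = θ.γ :=
  ⟨fun F θ hP g₀ os => rateCarriersOfRecord₁₂ 𝔯 F θ hP g₀ os (ksel F θ g₀ os),
    fun F θ hP hθ g₀ os => ratesAt_of_k4_rRec₁₂On 𝔯 _ h14 h15 h16 h17 h18 h22 F θ hP trivial hθ g₀ os _, fun _ _ _ _ _ => rfl⟩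

/-- **… WITH N17 GLUED** (`N17_of_U3edge`: (D4) ∧ N18 ∧ N22 ⇒ N17 at any home): five stubs + (D4) suffice. -/
theorem exists_keyedRates_window_of_k4_rRec₁₂On_true_glueN17 (ksel : (F : T4Family) → Stage12Params F N → (ℕ → ℝ) → List (ULoop F) → ℕ)
    (h14 : S_N14 (RRec₁₂On 𝔯 fun _ _ => True)) (h15 : S_N15 (RRec₁₂On 𝔯 fun _ _ => True)) (h16 : S_N16 (RRec₁₂On 𝔯 fun _ _ => True))
    (h18 : S_N18 (RRec₁₂On 𝔯 fun _ _ => True)) (h22 : S_N22 (RRec₁₂On 𝔯 fun _ _ => True)) (hD4 : S_D4 (RRec₁₂On 𝔯 fun _ _ => True)) :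
    ∃ rr : (F : T4Family) → (θ : Stage12Params F N) → θ.Provisos₁₂ F N → (ℕ → ℝ) → List (ULoop F) → RateCarriers N,
      (∀ (F : T4Family) (θ : Stage12Params F N) (hP : θ.Provisos₁₂ F N), θ.Admissible F N → ∀ (g₀ : ℕ → ℝ) (os : List (ULoop F)),
          RatesAt (datumOfRecord₁₂ F N θ hP) (rr F θ hP g₀ os)) ∧
        ∀ (F : T4Family) (θ : Stage12Params F N) (hP : θ.Provisos₁₂ F N) (g₀ : ℕ → ℝ) (os : List (ULoop F)), (rr F θ hP g₀ os).u3.γ = θ.γ :=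
  exists_keyedRates_window_of_k4_rRec₁₂On_true 𝔯 ksel h14 h15 h16 (N17_of_U3edge _ hD4 h18 h22) h18 h22

end YMDAG.UVSplit

end
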